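import Summits.HubbardSuperconductivity.HubbardLadder.Bounds.ThermalKuboCurvatureNumberConserving
import HarnessLib

/-!
# Bounds node: the thermal Kubo-curvature ceiling for the general number-conserving class in
# terms of three Gibbs moments (Falk–Bruch), any finite hopping graph, any coordinate sector

HONEST FRAMING: ladder R1–R4 with certified numbers; no claim on H/H₀. This file states BOUNDS FOR
A MODEL CLASS (no materials claim) and proves them; nothing here is a cited fact.

Cell `pub-hubbard`, unit `pub-hubbard-bounds` (gen 9), `paper/bounds.tex` Theorem 6_T (iii)
(= the class version of Theorem 5_T (ii) / `ThermalCurrentMomentFalkBruchCeilingTT'`). Setting of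
`ThermalKuboCurvatureNumberConserving.lean`: `Λ` finite, `t` symmetric real, `d` antisymmetric,
`V` any Hermitian Fock matrix, `β > 0`, `p` any set of occupation configurations,
`H_p = (T(t) + V)|_p`, `J_p = T(i t d)|_p`, `b = Re (J_p, J_p)_β` (Duhamel), `g = Re⟨J_p²⟩_β`,
`c = Re⟨J_p [H_p, J_p] − [H_p, J_p] J_p⟩_β`.

* `ThermalKuboCurvatureFalkBruchCeilingNumberConserving` (THEOREM): under the hypothesis
  `β ρ θ² ≤ log Z_p(H(0)) − log Z_p(H(θd))` (`|θ| ≤ θ₀`):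
  (i) `ρ ≤ G₁^β(d) − (β/2) b`, (ii) `g ≤ b + ½ √(β b c)` (Falk–Bruch, DLS78 Thm 3.1),
  (iii) `0 ≤ b`, (iv) `0 ≤ c`, (v) `Re⟨J_p⟩_β = 0`. Consequently (paper, elementary algebra)
  `b ≥ b_* := (√(βc/16 + g) − √(βc/16))²` and `ρ ≤ G₁^β(d) − (β/2) b_*`: a ceiling on every
  admissible stiffness coefficient by the three Gibbs moments `G₁^β(d)`, `⟨J_p²⟩`,
  `⟨[J_p,[H_p,J_p]]⟩` of the unperturbed sector Gibbs state, for the whole class.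
* `ThermalKuboCurvatureFalkBruchCeilingNumberConservingGauge` (THEOREM): with `V` invariant under
  every site-phase gauge, the same five conclusions for `d + dχ`, every `χ : Λ → ℝ`.

References: DLS1978 Thm 3.1 (Falk–Bruch); ScalapinoWhiteZhang1993 §II;
ParamekantiTrivediRanderia1998 §IV; HazraVermaRanderia2019 eq. (2).
-/

noncomputable section

namespace Summit.HubbardSuperconductivity.HubbardLadder.Bounds

open Matrix Finset Literature.MathematicalPhysics.QuantumLattice
  Literature.MathematicalPhysics.QuantumFieldTheory

open scoped ComplexConjugate ComplexOrder

/-- **Node (THEOREM, proved below): thermal Kubo-curvature ceiling with the Falk–Bruch moment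
bound, full number-conserving class, any finite hopping graph, any coordinate sector, `T > 0`.**
With `H_p = (T(t)+V)|_p`, `J_p = T(i t d)|_p`, `b = Re duhamel β H_p J_p J_p`,
`c = Re⟨J_p[H_p,J_p] − [H_p,J_p]J_p⟩`: the flux-floor hypothesis of
`ThermalKuboCurvatureCeilingNumberConserving` implies (i) `ρ ≤ G₁^β(d) − (β/2) b`,
(ii) `Re⟨J_p²⟩ ≤ b + ½√(β b c)`, (iii) `0 ≤ b`, (iv) `0 ≤ c`, (v) `Re⟨J_p⟩ = 0`.
[cite: DLS1978, Thm. 3.1] [cite: ScalapinoWhiteZhang1993, §II] -/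
@[conjecture] def ThermalKuboCurvatureFalkBruchCeilingNumberConserving : Prop :=
  ∀ (Λ : Type) [LinearOrder Λ] [Fintype Λ] (t d : Λ → Λ → ℝ), (∀ x y, t y x = t x y) →
    (∀ x y, d y x = -d x y) → ∀ (V : Matrix (Finset (Orb Λ)) (Finset (Orb Λ)) ℂ), V.IsHermitian →
    ∀ (β : ℝ), 0 < β → ∀ (p : Finset (Orb Λ) → Prop) [Fintype {a // p a}] [DecidableEq {a // p a}]
      (ρ θ₀ : ℝ), 0 < θ₀ →
      (∀ θ : ℝ, |θ| ≤ θ₀ →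
        β * (ρ * θ ^ 2) ≤
          Real.log (partitionFn β ((bdgHopping (fun x y => (t x y : ℂ)) + V).toBlock p p)).re -
            Real.log (partitionFn β
              ((bdgHopping (fun x y => (t x y : ℂ) *
                  Complex.exp (((θ * d x y : ℝ) : ℂ) * Complex.I)) + V).toBlock p p)).re) →
      let Hp := (bdgHopping (fun x y => (t x y : ℂ)) + V).toBlock p p
      let Jp := (bdgHopping fun x y => ((t x y * d x y : ℝ) : ℂ) * Complex.I).toBlock p p
      ρ ≤ (∑ x : Λ, ∑ y : Λ, ∑ σ : Fin 2, d x y ^ 2 *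
            (-(t x y * (gibbsState β Hp
              ((creation (orb x σ) * annihilation (orb y σ)).toBlock p p)).re) / 2)) -
          β / 2 * (duhamel β Hp Jp Jp).re ∧
        (gibbsState β Hp (Jp * Jp)).re ≤ (duhamel β Hp Jp Jp).re +
          1 / 2 * Real.sqrt (β * (duhamel β Hp Jp Jp).re *
            (gibbsState β Hp (Jp * (Hp * Jp - Jp * Hp) - (Hp * Jp - Jp * Hp) * Jp)).re) ∧
        0 ≤ (duhamel β Hp Jp Jp).re ∧
        0 ≤ (gibbsState β Hp (Jp * (Hp * Jp - Jp * Hp) - (Hp * Jp - Jp * Hp) * Jp)).re ∧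
        (gibbsState β Hp Jp).re = 0

/-- **Node (THEOREM, proved below): gauge form.** With `V` invariant under every site-phase gauge,
the five conclusions of `ThermalKuboCurvatureFalkBruchCeilingNumberConserving` hold with `d`
replaced by `d + dχ` for every `χ : Λ → ℝ`. [cite: DLS1978, Thm. 3.1]
[cite: ParamekantiTrivediRanderia1998, §IV] -/
@[conjecture] def ThermalKuboCurvatureFalkBruchCeilingNumberConservingGauge : Prop :=
  ∀ (Λ : Type) [LinearOrder Λ] [Fintype Λ] (t d : Λ → Λ → ℝ), (∀ x y, t y x = t x y) →
    (∀ x y, d y x = -d x y) → ∀ (V : Matrix (Finset (Orb Λ)) (Finset (Orb Λ)) ℂ), V.IsHermitian →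
    (∀ φ : Λ → ℝ, (phaseGauge fun x => Circle.exp (φ x))ᴴ * V *
      phaseGauge (fun x => Circle.exp (φ x)) = V) →
    ∀ (β : ℝ), 0 < β → ∀ (p : Finset (Orb Λ) → Prop) [Fintype {a // p a}] [DecidableEq {a // p a}]
      (ρ θ₀ : ℝ), 0 < θ₀ →
      (∀ θ : ℝ, |θ| ≤ θ₀ →
        β * (ρ * θ ^ 2) ≤
          Real.log (partitionFn β ((bdgHopping (fun x y => (t x y : ℂ)) + V).toBlock p p)).re -
            Real.log (partitionFn β
              ((bdgHopping (fun x y => (t x y : ℂ) *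
                  Complex.exp (((θ * d x y : ℝ) : ℂ) * Complex.I)) + V).toBlock p p)).re) →
      ∀ χ : Λ → ℝ,
      let Hp := (bdgHopping (fun x y => (t x y : ℂ)) + V).toBlock p p
      let Jp := (bdgHopping fun x y =>
        ((t x y * (d x y + (χ y - χ x)) : ℝ) : ℂ) * Complex.I).toBlock p p
      ρ ≤ (∑ x : Λ, ∑ y : Λ, ∑ σ : Fin 2, (d x y + (χ y - χ x)) ^ 2 *
            (-(t x y * (gibbsState β Hp
              ((creation (orb x σ) * annihilation (orb y σ)).toBlock p p)).re) / 2)) -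
          β / 2 * (duhamel β Hp Jp Jp).re ∧
        (gibbsState β Hp (Jp * Jp)).re ≤ (duhamel β Hp Jp Jp).re +
          1 / 2 * Real.sqrt (β * (duhamel β Hp Jp Jp).re *
            (gibbsState β Hp (Jp * (Hp * Jp - Jp * Hp) - (Hp * Jp - Jp * Hp) * Jp)).re) ∧
        0 ≤ (duhamel β Hp Jp Jp).re ∧
        0 ≤ (gibbsState β Hp (Jp * (Hp * Jp - Jp * Hp) - (Hp * Jp - Jp * Hp) * Jp)).re ∧
        (gibbsState β Hp Jp).re = 0

/-! ### Proofs -/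

section Proofs

variable {Λ : Type} [LinearOrder Λ] [Fintype Λ]

/-- Falk–Bruch bookkeeping for one Hermitian pair `(H_p, J_p)`: items (ii)–(iv). -/
theorem falkBruch_moments {m : Type*} [Fintype m] [DecidableEq m] {Hp Jp : Matrix m m ℂ}
    (hHp : Hp.IsHermitian) (hJp : Jp.IsHermitian) {β : ℝ} (hβ : 0 < β) :
    (gibbsState β Hp (Jp * Jp)).re ≤ (duhamel β Hp Jp Jp).re +
        1 / 2 * Real.sqrt (β * (duhamel β Hp Jp Jp).re *
          (gibbsState β Hp (Jp * (Hp * Jp - Jp * Hp) - (Hp * Jp - Jp * Hp) * Jp)).re) ∧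
      0 ≤ (duhamel β Hp Jp Jp).re ∧
      0 ≤ (gibbsState β Hp (Jp * (Hp * Jp - Jp * Hp) - (Hp * Jp - Jp * Hp) * Jp)).re := by
  have h := falkBruch_sum_le hHp hβ.le (A := fun _ : Unit => Jp) (fun _ => hJp)
  simp only [Finset.univ_unique, Finset.sum_singleton] at h
  exact ⟨h, hHp.re_duhamel_self_nonneg hJp β, hHp.re_gibbsState_doubleComm_nonneg hJp hβ.le⟩

/-- `ThermalKuboCurvatureFalkBruchCeilingNumberConserving` holds. -/
theorem thermalKuboCurvatureFalkBruchCeilingNumberConserving_holds :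
    ThermalKuboCurvatureFalkBruchCeilingNumberConserving := by
  intro Λ _ _ t d ht hd V hV β hβ p _ _ ρ θ₀ hθ₀ hstiff Hp Jp
  have hHp : Hp.IsHermitian := ((isHermitian_bdgHopping_real ht).add hV).submatrix _
  have hJp : Jp.IsHermitian := (isHermitian_current ht hd).submatrix _
  obtain ⟨h1, h2⟩ := thermalKuboCurvatureCeiling_numberConserving ht hd hV hβ p hθ₀ hstiff
  obtain ⟨h3, h4, h5⟩ := falkBruch_moments hHp hJp hβ
  exact ⟨h1, h3, h4, h5, h2⟩

/-- `ThermalKuboCurvatureFalkBruchCeilingNumberConservingGauge` holds. -/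
theorem thermalKuboCurvatureFalkBruchCeilingNumberConservingGauge_holds :
    ThermalKuboCurvatureFalkBruchCeilingNumberConservingGauge := by
  intro Λ _ _ t d ht hd V hV hVg β hβ p _ _ ρ θ₀ hθ₀ hstiff χ Hp Jp
  have hd' : ∀ x y, d y x + (χ x - χ y) = -(d x y + (χ y - χ x)) := fun x y => by
    rw [hd x y]; ring
  have hHp : Hp.IsHermitian := ((isHermitian_bdgHopping_real ht).add hV).submatrix _
  have hJp : Jp.IsHermitian :=
    (isHermitian_current (d := fun x y => d x y + (χ y - χ x)) ht hd').submatrix _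
  obtain ⟨h1, h2⟩ :=
    thermalKuboCurvatureCeilingNumberConservingGauge_holds Λ t d ht hd V hV hVg β hβ p ρ θ₀ hθ₀
      hstiff χ
  obtain ⟨h3, h4, h5⟩ := falkBruch_moments hHp hJp hβ
  exact ⟨h1, h3, h4, h5, h2⟩

end Proofs

end Summit.HubbardSuperconductivity.HubbardLadder.Bounds
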